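import Literature.Computability.AlgebraicComplexity.KoszulFlatteningGeneralDim
import Literature.Computability.AlgebraicComplexity.RankMethodBarriers
import Literature.Computability.AlgebraicComplexity.AsymptoticSpectrum
import Literature.Barriers.MatrixMultiplication.UniversalMethodBarrier
import HarnessLib

/-!
# The relative Koszul obstruction: `X ⊴ ⟨m⟩ ⊠ S ⟹ rank K_M(X) ≤ m · F(S)`

Solo-blind seat `solo-MatrixMultiplication-blind`, session s8 (paper.md §17.7, Lemma 17.2 (a), (b)).

The RELATIVE (common-factor) degeneration door of `SoloBlindRelativeDegeneration.lean` asks for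
identities `⟨m⟩ ⊠ T^{⊠j} ⊵ T^{⊠(j+d)}` with `m < R̃-record^d`.  This file proves the obstruction used
to prune its windows: Koszul flattening ranks (Landsberg–Ottaviani) are

* functorial under substitutions on the three legs (`soloKos_koszulFlatteningGen_subst`: the
  flattening of `(A, B, C) · t` after `M` is `P_C · K_{M Aᵀ}(t) · Q_B`), hence
* bounded along a polynomial degeneration `t ⊵ s` (Alman's `PolyDegeneratesTo`) by the supremum of
  the flattening ranks of `t` over the rational function field
  (`soloKos_rank_le_of_polyDegeneratesTo`, via the tree's algebraic semicontinuity lemma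
  `rank_le_rank_map_of_perturbation`), and
* sub-additive over the `m` blocks of `⟨m⟩ ⊠ S` (`soloKos_rank_multiple_le`).

Together (`soloKos_relativeKoszul`): if every Koszul flattening `K_{M'}(S)` of format `(q, p)` over every
field extension has rank `≤ B`, and `⟨m⟩ ⊠ S ⊵ X`, then every `K_M(X)` has rank `≤ m · B`; so a single
flattening of `X` of rank `> m · B` forbids the degeneration (`soloKos_not_polyDegeneratesTo`).  With
`m ↦ 1`, `S ↦ ⟨r⟩` this is the classical border-rank bound; the relative form is what excludes, e.g.,
`T_cw,2^{⊠4} ⊴ ⟨10⟩ ⊠ T_cw,2^{⊠2}` (rank `10122 > 10 · 934` at `(q, p) = (9, 4)`, a computation recorded in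
the seat's notes, not certified here).

## References
* J. M. Landsberg, G. Ottaviani, Theory of Computing 11 (2015) 285–298, Thm. 2.1. [LandsbergOttaviani2015]
* A. Conner, F. Gesmundo, J. M. Landsberg, E. Ventura, comput. complexity 31 (2022), §3–§4
  (Koszul flattenings of Kronecker powers, Prop. 4.1). [ConnerGesmundoLandsbergVentura2022]
* J. Alman, Limits on the universal method for matrix multiplication, Theory of Computing 17 (2021),
  §2.4 (degenerations over `K[λ]`). [Alman2021]
-/

open scoped BigOperators Polynomial Matrix
open Matrix Polynomial

namespace Summit.MatrixMultiplication.MatrixMultiplication.Theorems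

open Literature.Computability.AlgebraicComplexity
open Literature.Barriers.MatrixMultiplication

universe u

/-! ## Functoriality of the Koszul flattening under substitutions -/

section Substitute

variable {R : Type*} [CommRing R]
variable {ι κ μ ι' κ' μ' : Type*} [Fintype ι] [Fintype κ] [Fintype μ] [Fintype ι']

/-- **Substitution formula.**  For the tensor `t' = (A, B, C) · t`,
`t'_{a'b'c'} = Σ_{a,b,c} t_{abc} A_{a a'} B_{b b'} C_{c c'}`, the Koszul flattening after
`M : R^{ι'} → R^q` factors as `P_C · K_{M Aᵀ}(t) · Q_B` with `P_C`, `Q_B` block-diagonal over the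
exterior-power index. [cite: LandsbergGCT2017, §2.4.2 (linearity of T ↦ T_A^{∧p})] -/
theorem soloKos_koszulFlatteningGen_subst (q p : ℕ) (M : Matrix (Fin q) ι' R)
    (t : ι → κ → μ → R) (A : ι → ι' → R) (B : κ → κ' → R) (C : μ → μ' → R) :
    koszulFlatteningGen q p M.mulVecLin
        (fun a' b' c' => ∑ a, ∑ b, ∑ c, t a b c * (A a a' * B b b' * C c c')) =
      Matrix.of (fun (r : PSub q (p + 1) × μ') (r₂ : PSub q (p + 1) × μ) =>
          if r.1 = r₂.1 then C r₂.2 r.2 else 0) *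
        koszulFlatteningGen q p (M * Matrix.of fun a' a => A a a').mulVecLin t *
        Matrix.of (fun (c₂ : PSub q p × κ) (c : PSub q p × κ') =>
          if c₂.1 = c.1 then B c₂.2 c.2 else 0) := by
  classical
  ext r c
  set A' : Matrix ι' ι R := Matrix.of fun a' a => A a a' with hA'
  -- the left-hand entry
  have hvec : (fun a' => ∑ a, ∑ b, ∑ c₀, t a b c₀ * (A a a' * B b c.2 * C c₀ r.2)) =
      ∑ b, ∑ c₀, (B b c.2 * C c₀ r.2) • A'.mulVec (fun a => t a b c₀) := by
    funext a'
    simp only [Finset.sum_apply, Pi.smul_apply, smul_eq_mul, Matrix.mulVec, dotProduct, hA',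
      Matrix.of_apply, Finset.mul_sum]
    rw [Finset.sum_comm]
    refine Finset.sum_congr rfl fun b _ => ?_
    rw [Finset.sum_comm]
    refine Finset.sum_congr rfl fun c₀ _ => Finset.sum_congr rfl fun a _ => ?_
    ring
  have hL : koszulFlatteningGen q p M.mulVecLin
        (fun a' b' c' => ∑ a, ∑ b, ∑ c, t a b c * (A a a' * B b b' * C c c')) r c =
      ∑ b, ∑ c₀, B b c.2 * C c₀ r.2 *
        wedgeMatrix ((M * A').mulVecLin fun a => t a b c₀) r.1.1 c.1.1 := by
    rw [koszulFlatteningGen_apply]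
    change wedgeMatrixLin (M.mulVecLin fun a' => ∑ a, ∑ b, ∑ c₀,
        t a b c₀ * (A a a' * B b c.2 * C c₀ r.2)) r.1.1 c.1.1 = _
    rw [hvec, map_sum, map_sum, Matrix.sum_apply]
    refine Finset.sum_congr rfl fun b _ => ?_
    rw [map_sum, map_sum, Matrix.sum_apply]
    refine Finset.sum_congr rfl fun c₀ _ => ?_
    rw [map_smul, map_smul, Matrix.smul_apply, smul_eq_mul, wedgeMatrixLin_apply,
      Matrix.mulVecLin_apply, Matrix.mulVecLin_apply, Matrix.mulVec_mulVec]
  -- the right-hand entry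
  have hPK : ∀ c₂ : PSub q p × κ,
      (Matrix.of (fun (r : PSub q (p + 1) × μ') (r₂ : PSub q (p + 1) × μ) =>
          if r.1 = r₂.1 then C r₂.2 r.2 else 0) *
        koszulFlatteningGen q p (M * A').mulVecLin t) r c₂ =
      ∑ c₀ : μ, C c₀ r.2 * koszulFlatteningGen q p (M * A').mulVecLin t (r.1, c₀) c₂ := by
    intro c₂
    rw [Matrix.mul_apply, Fintype.sum_prod_type, Finset.sum_comm]
    refine Finset.sum_congr rfl fun c₀ _ => ?_
    simp only [Matrix.of_apply, ite_mul, zero_mul]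
    rw [Finset.sum_ite_eq Finset.univ r.1, if_pos (Finset.mem_univ _)]
  have hR : (Matrix.of (fun (r : PSub q (p + 1) × μ') (r₂ : PSub q (p + 1) × μ) =>
          if r.1 = r₂.1 then C r₂.2 r.2 else 0) *
        koszulFlatteningGen q p (M * A').mulVecLin t *
        Matrix.of (fun (c₂ : PSub q p × κ) (c : PSub q p × κ') =>
          if c₂.1 = c.1 then B c₂.2 c.2 else 0)) r c =
      ∑ b, ∑ c₀, B b c.2 * C c₀ r.2 *
        wedgeMatrix ((M * A').mulVecLin fun a => t a b c₀) r.1.1 c.1.1 := by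
    rw [Matrix.mul_apply, Fintype.sum_prod_type, Finset.sum_comm]
    refine Finset.sum_congr rfl fun b _ => ?_
    simp only [hPK, Matrix.of_apply, mul_ite, mul_zero]
    rw [Finset.sum_ite_eq' Finset.univ c.1, if_pos (Finset.mem_univ _), Finset.sum_mul]
    refine Finset.sum_congr rfl fun c₀ _ => ?_
    rw [koszulFlatteningGen_apply]
    ring
  rw [hL, hR]

end Substitute

/-! ## Koszul ranks along a polynomial degeneration -/

section Degeneration

variable {K : Type u} [Field K]
variable {ι κ μ ι' κ' μ' : Type u} [Fintype ι] [Fintype κ] [Fintype μ] [Fintype ι'] [Fintype κ']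
  [Fintype μ']

/-- **Semicontinuity of Koszul ranks along a degeneration.**  If `t ⊵ s` (Alman's polynomial
degeneration) and every Koszul flattening `K_{M'}(t)` of format `(q, p)` over every field extension of
`K` has rank `≤ B`, then every `K_M(s)` has rank `≤ B`.  Proof: the degenerating family is
`εʰ (s + ε s₁) = (A, B, C)(ε) · t` over `K[ε]`; flatten, apply the tree's algebraic semicontinuity
`rank_le_rank_map_of_perturbation` over `K(ε)`, and bound the flattening of `(A, B, C) · t` by that of
`t` after `M Aᵀ` (`soloKos_koszulFlatteningGen_subst`). [cite: LandsbergOttaviani2015, Thm 2.1 (proof)] [cite: Alman2021, §2.4] -/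
theorem soloKos_rank_le_of_polyDegeneratesTo (q p : ℕ) {t : ι → κ → μ → K}
    {s : ι' → κ' → μ' → K} (hts : PolyDegeneratesTo t s) {B : ℕ}
    (hB : ∀ (L : Type u) [Field L] [Algebra K L] (M' : Matrix (Fin q) ι L),
      (koszulFlatteningGen q p M'.mulVecLin (fun a b c => algebraMap K L (t a b c))).rank ≤ B)
    (M : Matrix (Fin q) ι' K) :
    (koszulFlatteningGen q p M.mulVecLin s).rank ≤ B := by
  classical
  obtain ⟨h, A, Bm, Cm, hs⟩ := hts
  set T : ι' → κ' → μ' → K[X] :=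
    fun a' b' c' => ∑ a, ∑ b, ∑ c, Polynomial.C (t a b c) * (A a a' * Bm b b' * Cm c c') with hTdef
  have hT : ∀ a' b' c', ∀ j ≤ h, (T a' b' c').coeff j = if j = h then s a' b' c' else 0 :=
    fun a' b' c' j hj => hs a' b' c' j hj
  have hdvd : ∀ a' b' c', X ^ (h + 1) ∣ T a' b' c' - Polynomial.C (s a' b' c') * X ^ h := by
    intro a' b' c'
    rw [X_pow_dvd_iff]
    intro d hd
    rw [coeff_sub, coeff_C_mul_X_pow, hT a' b' c' d (by omega)]
    split_ifs <;> simp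
  choose T' hT' using hdvd
  have hTe : T = (X : K[X]) ^ h • ((fun a' b' c' => Polynomial.C (s a' b' c')) + (X : K[X]) • T') := by
    funext a' b' c'
    simp only [Pi.smul_apply, Pi.add_apply, smul_eq_mul]
    linear_combination hT' a' b' c'
  have hKF : koszulFlatteningGen q p (M.map (Polynomial.C : K →+* K[X])).mulVecLin T =
      (X : K[X]) ^ h • ((koszulFlatteningGen q p M.mulVecLin s).map (Polynomial.C : K →+* K[X]) +
        (X : K[X]) • koszulFlatteningGen q p (M.map (Polynomial.C : K →+* K[X])).mulVecLin T') := by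
    rw [hTe, koszulFlatteningGen_smul, koszulFlatteningGen_add, koszulFlatteningGen_smul,
      koszulFlatteningGen_mulVecLin_map]
  have hN : ∀ i j, koszulFlatteningGen q p (M.map (Polynomial.C : K →+* K[X])).mulVecLin T i j =
      (Polynomial.C (koszulFlatteningGen q p M.mulVecLin s i j) +
        X * koszulFlatteningGen q p (M.map (Polynomial.C : K →+* K[X])).mulVecLin T' i j) * X ^ h := by
    intro i j
    rw [hKF]
    simp only [Matrix.smul_apply, Matrix.add_apply, Matrix.map_apply, smul_eq_mul]
    ring
  let L := FractionRing K[X]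
  have key := rank_le_rank_map_of_perturbation (L := L) (koszulFlatteningGen q p M.mulVecLin s)
    (koszulFlatteningGen q p (M.map (Polynomial.C : K →+* K[X])).mulVecLin T')
    (koszulFlatteningGen q p (M.map (Polynomial.C : K →+* K[X])).mulVecLin T) h hN
  refine key.trans ?_
  rw [koszulFlatteningGen_mulVecLin_map]
  -- the mapped family is the substitution `(A, B, C)(ε) · t` over `L = K(ε)`
  have hmapT : (fun a' b' c' => algebraMap K[X] L (T a' b' c')) = fun a' b' c' =>
      ∑ a, ∑ b, ∑ c, algebraMap K L (t a b c) *
        (algebraMap K[X] L (A a a') * algebraMap K[X] L (Bm b b') * algebraMap K[X] L (Cm c c')) := by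
    funext a' b' c'
    simp only [hTdef, map_sum, map_mul]
    refine Finset.sum_congr rfl fun a _ => Finset.sum_congr rfl fun b _ =>
      Finset.sum_congr rfl fun c _ => ?_
    rw [IsScalarTower.algebraMap_apply K K[X] L, Polynomial.algebraMap_eq]
  rw [hmapT, soloKos_koszulFlatteningGen_subst]
  exact ((Matrix.rank_mul_le_left _ _).trans (Matrix.rank_mul_le_right _ _)).trans (hB L _)

/-- **Sub-additivity over the blocks of `⟨m⟩ ⊠ S`.**  If every Koszul flattening `K_{M'}(S)` of
format `(q, p)` has rank `≤ B`, then every `K_M(⟨m⟩ ⊠ S)` has rank `≤ m · B`: `⟨m⟩ ⊠ S = Σ_i S⁽ⁱ⁾`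
with `S⁽ⁱ⁾ = (Aᵢ, Bᵢ, Cᵢ) · S` the copy on the `i`-th block, flattening is additive, and rank is
sub-additive. [cite: LandsbergGCT2017, §2.4.2 (linearity of T ↦ T_A^{∧p})] -/
theorem soloKos_rank_multiple_le {L : Type u} [Field L] (q p : ℕ) (m : ℕ) (S : ι → κ → μ → L)
    {B : ℕ} (hB : ∀ M' : Matrix (Fin q) ι L, (koszulFlatteningGen q p M'.mulVecLin S).rank ≤ B)
    (M : Matrix (Fin q) (Fin m × ι) L) :
    (koszulFlatteningGen q p M.mulVecLin (kroneckerTensor (unitTensor L m) S)).rank ≤ m * B := by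
  classical
  -- block copies as substitutions
  have hsum : kroneckerTensor (unitTensor L m) S = ∑ i : Fin m, fun a' b' c' =>
      ∑ a, ∑ b, ∑ c, S a b c *
        ((if a' = (i, a) then (1 : L) else 0) * (if b' = (i, b) then (1 : L) else 0) *
          (if c' = (i, c) then (1 : L) else 0)) := by
    funext a' b' c'
    obtain ⟨i₀, a₀⟩ := a'
    obtain ⟨i₁, b₀⟩ := b'
    obtain ⟨i₂, c₀⟩ := c'
    simp only [Finset.sum_apply, kroneckerTensor_apply, unitTensor_apply, Prod.mk.injEq]
    simp only [mul_ite, mul_one, mul_zero, ite_mul, zero_mul, one_mul]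
    simp only [ite_and]
    by_cases h01 : i₀ = i₁ <;> by_cases h12 : i₁ = i₂ <;> simp [h01, h12]
  rw [hsum, koszulFlatteningGen_sum]
  refine (matrix_rank_sum_le _ _).trans ?_
  calc ∑ i : Fin m, (koszulFlatteningGen q p M.mulVecLin (fun a' b' c' => ∑ a, ∑ b, ∑ c, S a b c *
          ((if a' = (i, a) then (1 : L) else 0) * (if b' = (i, b) then (1 : L) else 0) *
            (if c' = (i, c) then (1 : L) else 0)))).rank
      ≤ ∑ _i : Fin m, B := Finset.sum_le_sum fun i _ => by
          rw [soloKos_koszulFlatteningGen_subst]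
          exact ((Matrix.rank_mul_le_left _ _).trans (Matrix.rank_mul_le_right _ _)).trans (hB _)
    _ = m * B := by simp

/-- **The relative Koszul obstruction** (paper.md §17.7, Lemma 17.2 (a)+(b)).  If every Koszul
flattening `K_{M'}(S)` of format `(q, p)` over every field extension of `K` has rank `≤ B`, and
`⟨m⟩ ⊠ S ⊵ X` (the direct sum of `m` copies of `S` degenerates to `X`), then every Koszul flattening
`K_M(X)` of that format has rank `≤ m · B`. [cite: LandsbergOttaviani2015, Thm 2.1] [cite: Alman2021, §2.4] -/
theorem soloKos_relativeKoszul (q p : ℕ) (X : ι' → κ' → μ' → K) (S : ι → κ → μ → K) (m : ℕ)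
    {B : ℕ}
    (hB : ∀ (L : Type u) [Field L] [Algebra K L] (M' : Matrix (Fin q) ι L),
      (koszulFlatteningGen q p M'.mulVecLin (fun a b c => algebraMap K L (S a b c))).rank ≤ B)
    (h : PolyDegeneratesTo (kroneckerTensor (unitTensor K m) S) X) (M : Matrix (Fin q) ι' K) :
    (koszulFlatteningGen q p M.mulVecLin X).rank ≤ m * B := by
  refine soloKos_rank_le_of_polyDegeneratesTo q p h (fun L _ _ M' => ?_) M
  have hmap : (fun a b c => algebraMap K L (kroneckerTensor (unitTensor K m) S a b c)) =
      kroneckerTensor (unitTensor L m) (fun a b c => algebraMap K L (S a b c)) := by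
    funext a b c
    simp only [kroneckerTensor_apply, unitTensor_apply, map_mul]
    split_ifs <;> simp
  rw [hmap]
  exact soloKos_rank_multiple_le q p m _ (hB L) M'

/-- Contrapositive, the form used to close windows of the relative door: one Koszul flattening of `X`
of rank `> m · B` forbids `⟨m⟩ ⊠ S ⊵ X`. [cite: ConnerGesmundoLandsbergVentura2022, §3 eq. (8)] -/
theorem soloKos_not_polyDegeneratesTo (q p : ℕ) (X : ι' → κ' → μ' → K) (S : ι → κ → μ → K)
    (m : ℕ) {B : ℕ}
    (hB : ∀ (L : Type u) [Field L] [Algebra K L] (M' : Matrix (Fin q) ι L),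
      (koszulFlatteningGen q p M'.mulVecLin (fun a b c => algebraMap K L (S a b c))).rank ≤ B)
    (M : Matrix (Fin q) ι' K) (hM : m * B < (koszulFlatteningGen q p M.mulVecLin X).rank) :
    ¬ PolyDegeneratesTo (kroneckerTensor (unitTensor K m) S) X :=
  fun h => absurd (hM.trans_le (soloKos_relativeKoszul q p X S m hB h M)) (lt_irrefl _)

end Degeneration

end Summit.MatrixMultiplication.MatrixMultiplication.Theorems
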